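import Mathlib
import Literature.Barriers.ValiantsHypothesis.AlgebraicNaturalProofs
import Summits.ValiantsHypothesis.ValiantsHypothesis.Theorems.BarrierLeverPartitionMinorsHitByVPAutomorphicLayouts
import Summits.ValiantsHypothesis.ValiantsHypothesis.Theorems.BarrierLeverPartitionMinorsHitByVPSplitDoor

/-!
# Route BarrierLever — item `PartitionMinorsHitByVP` (stmt-ValiantsHypothesis-19717):
# PIECEWISE-AUTOMORPHIC layouts along a bi-threshold cut are hit, `b = 3`

Helper file (`--supports stmt-ValiantsHypothesis-19717`; cell valiant-natproofs, rung V4, 𝒟-side,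
prover seat valiant-natproofs-prover gen 6). Definition-free. Closes NO item. First use of the
general split door (`…SplitDoor.partitionMinor_hit_of_split`, p442956) with non-product-state
leaves: the two threshold cells are AUTOMORPHIC images under two DIFFERENT cube automorphisms
`S ↦ σ₁(S ∆ s₁)`, `S ↦ σ₂(S ∆ s₂)`; each cell is certified by its twisted diagonal state
(`…Automorphic.coeff_twistedDiag`: the cell matrix is the identity), and the split door glues them.

**Theorem (`partitionMinor_hit_of_piecewiseAutomorphic`).** Let `u` be injective, `λ, μ : Fin h → ℤ`
with cuts `cu, cw`, `e` a bijection from the rows above the `λ`-cut onto the columns above the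
`μ`-cut and `e'` one between the complements, such that `w (e i) = σ₁((u i) ∆ s₁)` on the first cell
and `w (e' i) = σ₂((u i) ∆ s₂)` on the second. Then (`h ≥ 2`) some `f ∈ SmallCircuits ℂ (h+h) 3`
makes the layout matrix of item 19717 nonsingular. (`σ₁ = σ₂`, `s₁ = s₂` is the automorphic class of
`…Automorphic.partitionMinor_hit_of_automorphic`; here the two halves may be moved differently.)

WHAT THIS IS NOT: a structured class only; nothing on general layouts, crux 14610 or VP vs VNP.
-/

set_option linter.dupNamespace false

namespace Summit.ValiantsHypothesis.ValiantsHypothesis.Theorems.BarrierLever.SplitDoor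

open Finset
open Literature.Barriers.ValiantsHypothesis
open Summit.ValiantsHypothesis.ValiantsHypothesis.Theorems.BarrierLever.Automorphic
  (coeff_twistedDiag twistedDiag_mem_smallCircuits)

variable {h r : ℕ}

/-- An automorphic CELL (rows `{i // p i}`, columns `e i`, `w (e i) = σ((u i) ∆ s)`) has the identity
as cell matrix at the twisted diagonal state, hence a nonsingular one. -/
theorem cell_det_twistedDiag_ne_zero (u w : Fin r → Finset (Fin h)) (hu : Function.Injective u)
    {p q : Fin r → Prop} [DecidablePred p] (e : {i // p i} ≃ {j // q j}) (σ : Equiv.Perm (Fin h))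
    (s : Finset (Fin h))
    (hw : ∀ i : {i // p i}, w (e i).1 = (symmDiff (u i.1) s).image σ) :
    (Matrix.of fun i i' : {i // p i} => MvPolynomial.coeff
        (∑ a ∈ u i.1, Finsupp.single (Fin.castAdd h a) 1 +
          ∑ c ∈ w (e i').1, Finsupp.single (Fin.natAdd h c) 1)
        (∏ a : Fin h, (if a ∈ s then MvPolynomial.X (Fin.natAdd h (σ a)) + MvPolynomial.X (Fin.castAdd h a)
          else 1 + MvPolynomial.X (Fin.castAdd h a) * MvPolynomial.X (Fin.natAdd h (σ a))) :
          MvPolynomial (Fin (h + h)) ℂ)).det ≠ 0 := by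
  classical
  have hinj : ∀ A B : Finset (Fin h), (symmDiff A s).image σ = (symmDiff B s).image σ ↔ A = B := by
    intro A B
    constructor
    · intro hAB
      have h1 : symmDiff A s = symmDiff B s := (Finset.image_injective σ.injective) hAB
      simpa [symmDiff_left_inj] using congrArg (fun C => symmDiff C s) h1
    · rintro rfl
      rfl
  have hM : (Matrix.of fun i i' : {i // p i} => MvPolynomial.coeff
        (∑ a ∈ u i.1, Finsupp.single (Fin.castAdd h a) 1 +
          ∑ c ∈ w (e i').1, Finsupp.single (Fin.natAdd h c) 1)
        (∏ a : Fin h, (if a ∈ s then MvPolynomial.X (Fin.natAdd h (σ a)) + MvPolynomial.X (Fin.castAdd h a)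
          else 1 + MvPolynomial.X (Fin.castAdd h a) * MvPolynomial.X (Fin.natAdd h (σ a))) :
          MvPolynomial (Fin (h + h)) ℂ)) = 1 := by
    ext i i'
    rw [Matrix.of_apply, coeff_twistedDiag, hw i', Matrix.one_apply]
    simp only [hinj, hu.eq_iff]
    by_cases hii : i = i'
    · subst hii
      simp
    · rw [if_neg (fun hh => hii (Subtype.ext hh).symm), if_neg hii]
  rw [hM, Matrix.det_one]
  exact one_ne_zero

/-- **Piecewise-automorphic layouts along a bi-threshold cut are hit** (`b = 3`, `h ≥ 2`). -/
theorem partitionMinor_hit_of_piecewiseAutomorphic (hh : 2 ≤ h) (u w : Fin r → Finset (Fin h))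
    (hu : Function.Injective u) (lam mu : Fin h → ℤ) (cu cw : ℤ)
    (e : {i : Fin r // cu < ∑ a ∈ u i, lam a} ≃ {j : Fin r // cw < ∑ c ∈ w j, mu c})
    (e' : {i : Fin r // ¬ cu < ∑ a ∈ u i, lam a} ≃ {j : Fin r // ¬ cw < ∑ c ∈ w j, mu c})
    (σ₁ σ₂ : Equiv.Perm (Fin h)) (s₁ s₂ : Finset (Fin h))
    (hw₁ : ∀ i : {i : Fin r // cu < ∑ a ∈ u i, lam a}, w (e i).1 = (symmDiff (u i.1) s₁).image σ₁)
    (hw₂ : ∀ i : {i : Fin r // ¬ cu < ∑ a ∈ u i, lam a}, w (e' i).1 = (symmDiff (u i.1) s₂).image σ₂) :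
    ∃ f ∈ SmallCircuits ℂ (h + h) 3,
      (Matrix.of fun i j : Fin r => MvPolynomial.coeff
        (∑ a ∈ u i, Finsupp.single (Fin.castAdd h a) 1 +
          ∑ c ∈ w j, Finsupp.single (Fin.natAdd h c) 1) f).det ≠ 0 := by
  classical
  have h1 : 1 ≤ h := by omega
  exact partitionMinor_hit_of_split h r 2 hh (by norm_num) u w lam mu cu cw e e' _ _
    (twistedDiag_mem_smallCircuits h1 σ₁ s₁) (twistedDiag_mem_smallCircuits h1 σ₂ s₂)
    (cell_det_twistedDiag_ne_zero u w hu e σ₁ s₁ hw₁)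
    (cell_det_twistedDiag_ne_zero u w hu e' σ₂ s₂ hw₂)

end Summit.ValiantsHypothesis.ValiantsHypothesis.Theorems.BarrierLever.SplitDoor
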